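import Summits.HodgeConjecture.CorCM.MultiFieldWeilOrbitCounting
import Summits.HodgeConjecture.CorCM.MultiFieldWeilJointPrimesHodge
import Summits.HodgeConjecture.CorCM.SexticOcticWeilHodgeOfMarkman
import Mathlib.Algebra.Polynomial.SpecificDegree
import HarnessLib

/-!
# MULTI-FIELD WEIL ENGINE — TWO `(1,2)`-THREEFOLDS OVER NON-ISOMORPHIC SEXTIC CM FIELDS SHARING `k` (Galois or not): the Hodge conjecture for every
# product of copies of `E`, `T₀`, `T₁`, given ONLY Markman's fourfold theorem — the joint hypothesis discharged by a cubic-has-a-root argument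

Cell `pub-hodgecm2` (COR-CM), seat b30 gen 31 (2026-08-24); count-neutral own lane MULTI-FIELD WEIL ENGINE (stem `MultiFieldWeil*`), sequel of
`CorCM/MultiFieldWeilOrbitCounting.lean` (orbit counting: `exists_ringEquiv_fix_comp_eq_comp_of_finrank`) and `CorCM/MultiFieldWeilJointPrimesHodge.lean` (T7,
`hodgeConjectureFor_biproduct_comp_of_sextics`).  Theorems only; no definition, no named fact, no `sorry`.
HONEST FRAMING: conditional on the displayed Markman fourfold binder only; `HC_CM` is NOT proved and not asserted.

THE FIELD-THEORETIC LEMMA (§1, **`finrank_adjoin_pair_of_isEmpty_ringHom`**).  `k ⊂ K₀`, `k ⊂ K₁` number fields with `[K_j : k] = 3` and NO ring homomorphism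
`K₁ → K₀`; `τ`, `s₀ ⊃ τ`, `s₁ ⊃ τ` complex embeddings.  Then `[ℚ(τk) · s₀(K₀) · s₁(K₁) : ℚ] = 9 [k : ℚ]`, i.e. `s₀(K₀)` and `s₁(K₁)` are linearly disjoint over
`τ(k)`.  Proof: for a primitive element `β` of `K₁` the minimal polynomial `q` of `β` over `k` is a cubic; transported to `A = s₀(K₀)` along `τ` it has the root
`s₁(β)` and NO root in `A` (a root `s₀(γ₀)` would give `q(γ₀) = 0` in `K₀`, hence a `k`-embedding `K₁ = k(β) → K₀`), so — being a CUBIC — it is irreducible over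
`A` (Mathlib `Polynomial.irreducible_of_degree_le_three_of_not_isRoot`) and is the minimal polynomial of `s₁(β)` over `A`: `[A(s₁β) : A] = 3`.  (For two extensions of
the same PRIME degree `ℓ ≥ 5` "no root" no longer forces irreducibility; for `ℓ = 5` the statement survives by the classification of transitive quintic groups, for
`ℓ = 7` it fails — the `PSL₂(𝔽₇)` twins; neither is claimed here.)

THE HEADLINE (§2, **`hodgeConjectureFor_biproduct_comp_of_two_sextics_of_isEmpty`**).  `k = Kf i₀` imaginary quadratic with `E = A 0 ⊨ (k; {τ})`; two sextic CM fields
`K_m = Kf (is m) ⊇ im m (k)` (`m : Fin 2`), Galois or not, with `Hom(K₁, K₀) = ∅`; `T_m = A (m+1) ⊨ (K_m; Φ (m+1))` with exactly one member of `Φ (m+1)` over `τ`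
(`k`-signature `(1,2)`: simple CM threefolds).  Then the Hodge conjecture holds for EVERY product of copies `⨁_j A (κ j)` — `E^a × T₀^b × T₁^c`, any order — GIVEN ONLY
`Markman2025_weilClasses_algebraic_abelianFourfold`.  This removes the hypothesis "both `K_m` non-Galois" of
`TwoSexticFieldsThreefoldPair.hodgeConjectureFor_biproduct_comp_vec_of_markman` (gen 16) and the automorphism hypothesis `hH` ∕ `hJ` of the gen-30 towers for `r = 2`.
(Same field with two types: `SexticCMThreefoldPair…`; one threefold: `SexticCMThreefold…`; so together every pair of simple CM threefolds whose sextic CM fields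
contain `k` is covered modulo Markman's fourfold theorem — the assembly is not restated here.)

[cite: Markman2025SurveySecant, Thm. 1.2] [cite: Lang2002, V §1 Prop. 1.2, VI §1 Thm. 1.1, Cor. 1.6 and V §2 Thm. 2.8] [cite: Shimura1998, §18.2 Lemma (i)]

## References
* [Markman2025SurveySecant] E. Markman, arXiv:2509.23403, Thm. 1.2.  [Lang2002] S. Lang, *Algebra*, GTM 211, V §1 Prop. 1.2 (tower law), V §2 Thm. 2.8, VI §1.
  [Shimura1998] G. Shimura, *Abelian varieties with complex multiplication and modular functions*, §18.2 Lemma (i).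
-/

noncomputable section

open CategoryTheory CategoryTheory.Limits NumberField IntermediateField Polynomial

namespace Summit.HodgeConjecture.CorCM.MultiFieldWeil

open Finset
open Literature.AlgebraicGeometry Literature.AlgebraicGeometry.Motives Literature.AlgebraicGeometry.HodgeTheory
open Literature.AlgebraicGeometry.ComplexMultiplication (IsCMTypeRealisation)
open Literature.AlgebraicTopology.SingularHomology
open Literature.NumberTheory.ComplexMultiplication

open scoped Classical

/-! ## §1 Two extensions of relative degree `3` without homomorphisms between them are linearly disjoint -/

section Cubic

variable {k K₀ K₁ : Type} [Field k] [NumberField k] [Field K₀] [NumberField K₀] [Field K₁] [NumberField K₁]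

/-- **TWO RELATIVE CUBICS WITHOUT HOMOMORPHISMS ARE LINEARLY DISJOINT.**  `i_j : k → K_j` with `[K_j : ℚ] = 3 [k : ℚ]`, `Hom(K₁, K₀) = ∅`; `s_j : K_j → ℂ` complex
embeddings over `τ : k → ℂ`.  Then the subfield `ℚ(τk) ⊔ ℚ(s₀(K₀) ∪ s₁(K₁))` of `ℂ` has degree `9 [k : ℚ]` over `ℚ`.  (The minimal polynomial over `k` of a primitive
element `β` of `K₁` is a cubic with no root in `s₀(K₀)` — a root would give a `k`-embedding `K₁ → K₀` — hence irreducible over `s₀(K₀)`, so `[s₀(K₀)(s₁β) : s₀(K₀)] = 3`.)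
[cite: Lang2002, V §1 Prop. 1.2, VI §1 Thm. 1.1] -/
theorem finrank_adjoin_pair_of_isEmpty_ringHom (i₀ : k →+* K₀) (i₁ : k →+* K₁) (h₀ : Module.finrank ℚ K₀ = 3 * Module.finrank ℚ k)
    (h₁ : Module.finrank ℚ K₁ = 3 * Module.finrank ℚ k) (hK : IsEmpty (K₁ →+* K₀)) {τ : k →+* ℂ} {s₀ : K₀ →+* ℂ} {s₁ : K₁ →+* ℂ}
    (hs₀ : s₀.comp i₀ = τ) (hs₁ : s₁.comp i₁ = τ) :
    Module.finrank ℚ ↥(adjoin ℚ (Set.range τ) ⊔ adjoin ℚ (Set.range s₀ ∪ Set.range s₁)) = 9 * Module.finrank ℚ k := by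
  letI : Algebra k K₀ := i₀.toAlgebra
  letI : Algebra k K₁ := i₁.toAlgebra
  haveI : IsScalarTower ℚ k K₀ := IsScalarTower.of_algebraMap_eq fun q => by
    rw [RingHom.algebraMap_toAlgebra, eq_ratCast, eq_ratCast, map_ratCast]
  haveI : IsScalarTower ℚ k K₁ := IsScalarTower.of_algebraMap_eq fun q => by
    rw [RingHom.algebraMap_toAlgebra, eq_ratCast, eq_ratCast, map_ratCast]
  haveI : FiniteDimensional k K₁ := FiniteDimensional.right ℚ k K₁
  have hk1 : Module.finrank k K₁ = 3 := by
    have h := Module.finrank_mul_finrank ℚ k K₁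
    rw [h₁, mul_comm 3] at h
    exact Nat.eq_of_mul_eq_mul_left Module.finrank_pos h
  -- the image `A = s₀(K₀)`, a subfield of `ℂ` of degree `[K₀ : ℚ]` containing `τ(k)`
  set A : IntermediateField ℚ ℂ := adjoin ℚ (Set.range s₀) with hAdef
  have hfinA : Module.finrank ℚ A = Module.finrank ℚ K₀ := finrank_adjoin_range_ringHom s₀
  haveI : FiniteDimensional ℚ A := Module.finite_of_finrank_pos (by rw [hfinA]; exact Module.finrank_pos)
  have hτs₀ : ∀ x, τ x = s₀ (i₀ x) := fun x => by rw [← hs₀]; rfl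
  have hτA : ∀ x, τ x ∈ A := fun x => subset_adjoin ℚ _ ⟨i₀ x, (hτs₀ x).symm⟩
  let τA : k →+* A := τ.codRestrict A hτA
  have hτA_val : ∀ x, ((τA x : A) : ℂ) = τ x := fun x => rfl
  -- a primitive element `β` of `K₁` over `ℚ`, its image `b`, and its minimal polynomial `q` over `k` (a cubic)
  obtain ⟨β, hβ⟩ := Field.exists_primitive_element ℚ K₁
  set b : ℂ := s₁ β with hb
  have hβint : IsIntegral k β := IsIntegral.of_finite k β
  have hβtop : k⟮β⟯ = ⊤ := by
    rw [eq_top_iff]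
    intro x _
    have hx : x ∈ ℚ⟮β⟯ := by rw [hβ]; exact mem_top
    have hle : ℚ⟮β⟯ ≤ (k⟮β⟯).restrictScalars ℚ := adjoin_le_iff.2 (Set.singleton_subset_iff.2 (mem_adjoin_simple_self k β))
    exact hle hx
  set q : k[X] := minpoly k β with hq
  have hqdeg : q.natDegree = 3 := by
    rw [hq, ← adjoin.finrank hβint, hβtop, finrank_top', hk1]
  -- its transport `q'` to `A` along `τ` has the root `b`
  set q' : (A : Type)[X] := q.map τA with hq'
  have hq'monic : q'.Monic := (minpoly.monic hβint).map τA
  have hq'deg : q'.natDegree = 3 := by rw [hq', (minpoly.monic hβint).natDegree_map, hqdeg]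
  have hq'b : aeval b q' = 0 := by
    have h1 : (algebraMap A ℂ).comp τA = τ := RingHom.ext fun x => rfl
    rw [aeval_def, hq', eval₂_map, h1, ← hs₁, hb, ← Polynomial.hom_eval₂, ← RingHom.algebraMap_toAlgebra i₁, ← aeval_def, hq, minpoly.aeval,
      map_zero]
  -- and NO root in `A`: a root `s₀ γ₀` would give `q(γ₀) = 0` in `K₀`, hence a `k`-embedding `K₁ = k(β) → K₀`
  have hq'root : ∀ γ : A, ¬ q'.IsRoot γ := by
    intro γ hγ
    have hγA : (γ : ℂ) ∈ s₀.toRatAlgHom.fieldRange := by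
      rw [← adjoin_range_ringHom_eq_fieldRange]
      exact γ.2
    obtain ⟨γ₀, hγ₀⟩ := AlgHom.mem_fieldRange.1 hγA
    have hγ₀' : s₀ γ₀ = γ := hγ₀
    -- `q(γ₀) = 0` in `K₀`
    have hroot : aeval γ₀ q = 0 := by
      apply s₀.injective
      rw [map_zero, aeval_def, RingHom.algebraMap_toAlgebra, Polynomial.hom_eval₂, hs₀, hγ₀']
      have h1 : (algebraMap A ℂ) (q'.eval γ) = 0 := by rw [hγ.eq_zero, map_zero]
      have h2 : (algebraMap A ℂ).comp τA = τ := RingHom.ext fun x => rfl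
      rw [hq', Polynomial.eval_map, Polynomial.hom_eval₂, h2] at h1
      exact h1
    have hmem : γ₀ ∈ (minpoly k β).aroots K₀ := by
      rw [mem_aroots]
      exact ⟨minpoly.ne_zero hβint, hroot⟩
    let φ : k⟮β⟯ →ₐ[k] K₀ := (algHomAdjoinIntegralEquiv k hβint).symm ⟨γ₀, hmem⟩
    let e : K₁ ≃ₐ[k] k⟮β⟯ := (IntermediateField.topEquiv.symm.trans (IntermediateField.equivOfEq hβtop.symm))
    exact hK.false (φ.toRingHom.comp e.toAlgHom.toRingHom)
  -- hence `q'` is irreducible (a cubic) and is the minimal polynomial of `b` over `A`: `[A(b) : A] = 3`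
  have hq'irr : Irreducible q' :=
    irreducible_of_degree_le_three_of_not_isRoot (by rw [hq'deg]; exact Finset.mem_Icc.2 ⟨by norm_num, le_rfl⟩) hq'root
  have hbint : IsIntegral A b := ⟨q', hq'monic, by rwa [aeval_def] at hq'b⟩
  have hminb : (minpoly A b).natDegree = 3 := by
    rw [← minpoly.eq_of_irreducible_of_monic hq'irr hq'b hq'monic, hq'deg]
  have hAb : Module.finrank A A⟮b⟯ = 3 := by rw [adjoin.finrank hbint, hminb]
  -- the compositum is `A(b)`
  have hs₁b : Set.range s₁ ⊆ (ℚ⟮b⟯ : IntermediateField ℚ ℂ) := by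
    rintro y ⟨x, rfl⟩
    have hx : x ∈ ℚ⟮β⟯ := by rw [hβ]; exact mem_top
    have h : s₁.toRatAlgHom x ∈ (ℚ⟮β⟯).map s₁.toRatAlgHom := (IntermediateField.map_mem_map ℚ⟮β⟯ s₁.toRatAlgHom).2 hx
    rw [IntermediateField.adjoin_map, Set.image_singleton] at h
    exact h
  have hres : (A⟮b⟯).restrictScalars ℚ = A ⊔ ℚ⟮b⟯ := restrictScalars_adjoin_eq_sup ℚ A _
  have hF : adjoin ℚ (Set.range τ) ⊔ adjoin ℚ (Set.range s₀ ∪ Set.range s₁) = A ⊔ ℚ⟮b⟯ := by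
    rw [adjoin_union]
    apply le_antisymm
    · have hτ0 : Set.range τ ⊆ Set.range s₀ := by
        rintro y ⟨x, rfl⟩
        exact ⟨i₀ x, (hτs₀ x).symm⟩
      exact sup_le (le_sup_of_le_left (adjoin.mono ℚ _ _ hτ0)) (sup_le_sup_left (adjoin_le_iff.2 hs₁b) A)
    · have hb0 : ({b} : Set ℂ) ⊆ Set.range s₁ := Set.singleton_subset_iff.2 ⟨β, rfl⟩
      exact sup_le (le_sup_of_le_right le_sup_left) (le_sup_of_le_right (le_sup_of_le_right (adjoin.mono ℚ _ _ hb0)))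
  -- the tower law
  have hmul := Module.finrank_mul_finrank ℚ A A⟮b⟯
  rw [hAb, hfinA, h₀] at hmul
  have hfin : Module.finrank ℚ ↥(A ⊔ ℚ⟮b⟯) = Module.finrank ℚ A⟮b⟯ := by
    rw [← hres]
    rfl
  rw [hF, hfin, ← hmul]
  ring

end Cubic

/-! ## §2 The headline for two non-isomorphic sextic CM fields -/

section Engine

variable {I : Type} {Kf : I → Type} [∀ i, Field (Kf i)] [∀ i, NumberField (Kf i)] [∀ i, IsCMField (Kf i)]
  {i₀ : I} {is : Fin 2 → I} {τ : Kf i₀ →+* ℂ}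
  {A : Fin (2 + 1) → AbelianVariety ℂ} {Φ : ∀ j : Fin (2 + 1), CMType (Kf (mfSlots i₀ is j))}
  {ι : ∀ j, 𝓞 (Kf (mfSlots i₀ is j)) →+* End (A j)}
  {θ : ∀ j, Kf (mfSlots i₀ is j) →+* Module.End ℂ (complexBetti (A j).X 1)}

/-- **TWO `(1,2)`-THREEFOLDS OVER NON-ISOMORPHIC SEXTIC CM FIELDS SHARING `k` — given ONLY Markman's fourfold theorem.**  `k = Kf i₀` imaginary quadratic,
`E = A 0 ⊨ (k; {τ})`; `K_m = Kf (is m)` (`m : Fin 2`) SEXTIC CM fields containing `k` via `im m`, with NO ring homomorphism `K₁ → K₀` (non-isomorphic; Galois or not);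
`T_m = A (m+1) ⊨ (K_m; Φ (m+1))` with exactly one member of `Φ (m+1)` over `τ`.  Then the Hodge conjecture holds for EVERY product of copies `⨁_j A (κ j)`
(`E^a × T₀^b × T₁^c`, any number and order).  The joint-transitivity hypothesis `hJ` of `hodgeConjectureFor_biproduct_comp_of_sextics` is discharged by orbit
counting (`exists_ringEquiv_fix_comp_eq_comp_of_finrank`) and `finrank_adjoin_pair_of_isEmpty_ringHom`.  `HC_CM` is NOT asserted. [cite: Markman2025SurveySecant, Thm. 1.2] [cite: Lang2002, VI §1 Thm. 1.1, Cor. 1.6 and V §2 Thm. 2.8]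
[cite: Shimura1998, §18.2 Lemma (i)] -/
theorem hodgeConjectureFor_biproduct_comp_of_two_sextics_of_isEmpty (hW4 : Markman2025_weilClasses_algebraic_abelianFourfold)
    {N : ℕ} (κ : Fin N → Fin (2 + 1)) (h2 : Module.finrank ℚ (Kf i₀) = 2) (h6 : ∀ m : Fin 2, Module.finrank ℚ (Kf (is m)) = 6)
    (im : ∀ m : Fin 2, Kf i₀ →+* Kf (is m)) (hA : ∀ j, IsCMTypeRealisation (Φ j) (A j) (ι j) (θ j)) (hΨ : ∀ σ : Kf i₀ →+* ℂ, σ ∈ (Φ 0).1 ↔ σ = τ)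
    (h1 : ∀ m : Fin 2, (Finset.univ.filter fun s : Kf (is m) →+* ℂ => s.comp (im m) = τ ∧ s ∈ (Φ m.succ).1).card = 1)
    (hK : IsEmpty (Kf (is 1) →+* Kf (is 0))) :
    HodgeConjectureFor (⨁ fun j => A (κ j)).dim (⨁ fun j => A (κ j)).X := by
  -- a `τ`-embedding of each field
  have hex : ∀ m : Fin 2, ∃ s : Kf (is m) →+* ℂ, s.comp (im m) = τ := fun m => by
    have hc := SexticOcticWeil.card_filter_comp_eq_of_finrank (n := 3) (im m) (by rw [h6 m]) h2 τ
    obtain ⟨s, hs⟩ := Finset.card_pos.1 (by rw [hc]; norm_num)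
    exact ⟨s, (Finset.mem_filter.1 hs).2⟩
  choose s₀ hs₀ using hex
  -- the joint-transitivity hypothesis `hJ` of T7 by orbit counting over `M = ℚ(τk)`, the degree `18 = 2 · 3 · 3` from §1
  refine hodgeConjectureFor_biproduct_comp_of_sextics hW4 κ h2 h6 im hA hΨ h1 fun s s' hss' => ?_
  haveI : FiniteDimensional ℚ ↥(adjoin ℚ (Set.range τ)) :=
    Module.finite_of_finrank_pos (by rw [finrank_adjoin_range_ringHom]; exact Module.finrank_pos)
  have hU : (⋃ m : Fin 2, Set.range (s₀ m)) = Set.range (s₀ 0) ∪ Set.range (s₀ 1) := by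
    ext x
    simp only [Set.mem_iUnion, Set.mem_union, Fin.exists_fin_two]
  have hdeg' : Module.finrank ℚ ↥(adjoin ℚ (Set.range τ) ⊔ adjoin ℚ (⋃ m, Set.range (s₀ m))) =
      Module.finrank ℚ ↥(adjoin ℚ (Set.range τ)) * ∏ _m : Fin 2, 3 := by
    rw [hU, finrank_adjoin_pair_of_isEmpty_ringHom (im 0) (im 1) (by rw [h6 0, h2]) (by rw [h6 1, h2]) hK (hs₀ 0) (hs₀ 1), finrank_adjoin_range_ringHom, h2]
    norm_num
  obtain ⟨ρ, -, hρ⟩ := exists_ringEquiv_fix_comp_eq_comp_of_finrank (i := im) (adjoin ℚ (Set.range τ)) (fun x => subset_adjoin ℚ _ ⟨x, rfl⟩) s₀ hs₀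
    (fun _ => 3) (fun m => SexticOcticWeil.card_filter_comp_eq_of_finrank (im m) (by rw [h6 m]) h2 τ) hdeg' s s' (fun m => (hss' m).1) (fun m => (hss' m).2)
  exact ⟨ρ, hρ⟩

/-- **Dominated form**: every abelian variety dominated by such a product of copies satisfies the Hodge conjecture (given Markman's fourfold theorem).
[cite: Markman2025SurveySecant, Thm. 1.2] -/
theorem hodgeConjectureFor_of_avDominatedBy_comp_of_two_sextics_of_isEmpty (hW4 : Markman2025_weilClasses_algebraic_abelianFourfold)
    {N : ℕ} (κ : Fin N → Fin (2 + 1)) (h2 : Module.finrank ℚ (Kf i₀) = 2) (h6 : ∀ m : Fin 2, Module.finrank ℚ (Kf (is m)) = 6)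
    (im : ∀ m : Fin 2, Kf i₀ →+* Kf (is m)) (hA : ∀ j, IsCMTypeRealisation (Φ j) (A j) (ι j) (θ j)) (hΨ : ∀ σ : Kf i₀ →+* ℂ, σ ∈ (Φ 0).1 ↔ σ = τ)
    (h1 : ∀ m : Fin 2, (Finset.univ.filter fun s : Kf (is m) →+* ℂ => s.comp (im m) = τ ∧ s ∈ (Φ m.succ).1).card = 1)
    (hK : IsEmpty (Kf (is 1) →+* Kf (is 0))) {X : AbelianVariety ℂ} (hX : Domination.AVDominatedBy X (⨁ fun j => A (κ j))) :
    HodgeConjectureFor X.dim X.X :=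
  Domination.hodgeConjectureFor_of_avDominatedBy (hodgeConjectureFor_biproduct_comp_of_two_sextics_of_isEmpty hW4 κ h2 h6 im hA hΨ h1 hK) hX

end Engine

end Summit.HodgeConjecture.CorCM.MultiFieldWeil

end
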